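import Summits.BirchSwinnertonDyer.BirchSwinnertonDyer.Theorems.PrintCf2RubinValueTwoKatzMeasureJZeroSeamPerUnitFamily
import Literature.NumberTheory.EllipticCurves.DeShalitThetaTExpansionColemanValues
import HarnessLib

/-!
# The per-unit VALUES `hX`/`hΦ` of the `j = 0` seam for a family of units FROM THE BRIDGE IDENTITIES with one Tate unit (W1 wiring)

Cell `bsd-print-cf2`, width seat `bsd-line-cf2-p1-w8` g13 (PART 1b-core of the seam values V1); `--supports` the crux stmt-BirchSwinnertonDyer-20368
(helper, Theses-free).  THEOREMS ONLY; no `def`, no named fact, no `sorry`.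
`forall_map_relCoatesWiles_and_frob_eq_of_bridgeFamily` = -w2 g25's `exists_unit_forall_map_relCoatesWiles_and_frob_eq_of_divisionPoints` ((γ)-FAM,
p767783) with the division-point data REPLACED by their output, the bridge identities `g_{β_j} = (G_j ∘ [1]_{P′,f}) ∘ [a]_f` for ONE Tate unit `a`
(cf2c-w4's B10f-d `exists_unit_forall_relColemanSeries_eq_subst_subst_of_thetaReadings`, p768701): for every unit `j` and moment `k`,
`ρ(c_{β_j,k}) = φ_F(a)^{k+1}·ι⁻¹(−12(#S_j·E_{k+1}(Ω, L) − E_{k+1}(Ω, L′_j)))` and the Frobenius twin at `Ω′` — (β)′/(γ)′ `…_of_bridge_series` per unit, the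
conjugate presentation by `iterate_map_thetaTExpansion_of_semiconj` (one `φ`-step).  The complex readings go through an ARBITRARY `φ_ℂ : R → ℂ` with
`ρ ∘ ψ_𝔓 = ι⁻¹ ∘ φ_ℂ` (the consumer takes `φ_ℂ := ι̂ ∘ (τ⁻¹ •) ∘ j`, Q-θ), so the base point `Ω` here is the τ-moved one.  Nothing here closes a crux;
no summit statement is proved; BSD is not proved by any of this.
References: [deShalit1987] II §4.4 (iv), II §4.5 (iv), II §4.9 (ii), II §4.10 (26), II §4.14 (38) (p. 57–71).
-/


-- the summit namespace `Summit.BirchSwinnertonDyer.BirchSwinnertonDyer` repeats the problem name by design (D-0017)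
set_option linter.dupNamespace false
set_option autoImplicit false

noncomputable section

open scoped Classical
open PowerSeries IsDedekindDomain NumberField ValuativeRel Field PeriodPair
open Literature.NumberTheory.NumberFields Literature.NumberTheory.EllipticCurves
open Literature.NumberTheory.GaloisRepresentations Literature.NumberTheory.GaloisRepresentations.IsNonarchimedeanLocalField
  Literature.NumberTheory.GaloisRepresentations.LubinTate Literature.NumberTheory.EllipticCurves.FormalGroupChart

namespace Summit.BirchSwinnertonDyer.BirchSwinnertonDyer.Theorems.PrintCf2.KatzMeasureJZeroSeam

attribute [local instance] ltNormUniformSpace ltNormIsUniformAddGroup rk1 nF nE fintypeResidueField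

variable (K : Type) [Field K] [NumberField K] (v : HeightOneSpectrum (𝓞 K)) [v.asIdeal.LiesOver (ratPlace 2).asIdeal]
  (he : v.asIdeal.ramificationIdx (𝓞 ℚ) = 1) (hf : v.asIdeal.inertiaDeg (𝓞 ℚ) = 1)

set_option maxHeartbeats 1600000 in
/-- ★★ **`hX` and `hΦ` for a family of units from the BRIDGE identities with ONE Tate unit** (de Shalit II §4.10 (26) + §4.5 (iv) per unit): see the
module docstring. [cite: deShalit1987, II §4.5 (iv) (p. 57), II §4.9 Proposition (ii) (p. 63), II §4.10 (26) (p. 64), II §4.14 (38) (p. 71)] -/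
theorem forall_map_relCoatesWiles_and_frob_eq_of_bridgeFamily
    (hq : residueFieldCard (v.adicCompletion K) = 2)
    (h2 : (valuation (v.adicCompletion K)).IsUniformizer ((((2 : ℕ) : 𝒪[v.adicCompletion K]) : v.adicCompletion K)))
    (u : 𝒪[v.adicCompletion K]ˣ)
    (E : IntermediateField (v.adicCompletion K) (AlgebraicClosure (v.adicCompletion K)))
    [FiniteDimensional (v.adicCompletion K) E] [Normal (v.adicCompletion K) E] [IsGalois (v.adicCompletion K) E]
    (hE : E ≤ maxUnramified (v.adicCompletion K))
    {σ₀ : absoluteGaloisGroup (v.adicCompletion K)} (hσ₀ : IsAbsArithFrob σ₀)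
    (ρ : unitBall E →+* ℂ_[2]) (φF : v.adicCompletion K →+* ℂ_[2])
    (hρ : ρ.comp (algebraMap (LTCoeff (v.adicCompletion K)) (unitBall E)) =
      φF.comp ((algebraMap 𝒪[v.adicCompletion K] (v.adicCompletion K)).comp (LTCoeff.of (v.adicCompletion K)).symm.toRingHom))
    (ιp : PadicAlgCl 2 ≃+* ℂ)
    -- the `ℤ₂`-datum of the curve with its Lubin–Tate structure (`cm7Padic_exists_formalGroupLaw_eq_ltF`): `P ↦ exp_V(c·log_V)`, `V̂ = F_P`, `2 = ϖc`
    (V : WeierstrassCurve ℤ_[2]) {c : ℤ_[2]} {P : PowerSeries ℤ_[2]}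
    (hP : P.map PadicInt.Coe.ringHom =
      (V.map PadicInt.Coe.ringHom).formalExp.subst (C (c : ℚ_[2]) * (V.map PadicInt.Coe.ringHom).formalLog))
    {_hA : IsLTRing c 2} (hPlt : IsLTSeries c 2 P)
    (heπ : ((integerEquivAdicCompletionIntegers v).trans (padicIntEquivOfDegreeOne K 2 v he hf))
      ((u : 𝒪[v.adicCompletion K]) * ((2 : ℕ) : 𝒪[v.adicCompletion K])) = c)
    -- shared: the `𝔓`-adic reading of the theta data, the model, the semiconjugating endomorphism, the base point, the complex reading
    {R : Type*} [CommRing R] (ψ𝔓 : R →+* unitBall E) (WR : WeierstrassCurve R)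
    (x₀ y₀ : R) (φC : R →+* ℂ) (WC : WeierstrassCurve ℂ) (L : PeriodPair) (Ω : ℂ)
    (hg₂ : L.g₂ = WC.c₄ / 12) (hg₃ : L.g₃ = WC.c₆ / 216) (hV : WR.map φC = WC)
    (ha : φC x₀ = ℘[L] Ω - WC.b₂ / 12) (hb : φC y₀ = (℘'[L] Ω - WC.a₁ * (℘[L] Ω - WC.b₂ / 12) - WC.a₃) / 2)
    (hQθ : ρ.comp ψ𝔓 = ((algebraMap (PadicAlgCl 2) ℂ_[2]).comp ιp.symm.toRingHom).comp φC)
    (hW : (WR.map φC).map ((algebraMap (PadicAlgCl 2) ℂ_[2]).comp ιp.symm.toRingHom) =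
      (V.map (((padicEquivOfDegreeOne K 2 v he hf).symm.toRingHom).comp (PadicInt.Coe.ringHom (p := 2)))).map φF)
    -- per unit `j`: the unit, its presentation (complex data `L′ j ⊇ L` with representatives `S j`), its `τ`-symmetry, its values
    {J : Type*} (β : J → RelNormCoherentUnits (isUniformizer_unit_mul h2 u) E) (G : J → PowerSeries (unitBall E))
    (L' : J → PeriodPair) (S : J → Finset ℂ) (hS : ∀ j, L.IsLatticeReps (L' j) (S j)) (hΩ : ∀ j, Ω ∉ (L' j).lattice)
    (Kc : J → R) (x : J → ℂ → R) (uc : J → ℂ → Rˣ)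
    (hK : ∀ j, φC (Kc j) = L.deltaRatio (L' j) * (L.g₂ ^ 3 - 27 * L.g₃ ^ 2) ^ ((S j).card - 1))
    (hx : ∀ j, ∀ c ∈ (S j).erase 0, φC (x j c) = ℘[L] c - WC.b₂ / 12) (hu : ∀ j, ∀ c ∈ (S j).erase 0, (uc j c : R) = x₀ - x j c)
    (hG : ∀ j, G j = PowerSeries.map ψ𝔓 (C (Kc j) * ∏ c ∈ (S j).erase 0,
        PowerSeries.invOfUnit ((WR.translateX x₀ y₀).subst WR.formalNeg - C (x j c)) (uc j c) ^ 6))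
    -- the bridge identities for ONE Tate unit `a` (B10f-d `exists_unit_forall_relColemanSeries_eq_subst_subst_of_thetaReadings`)
    (a : 𝒪[v.adicCompletion K]ˣ)
    (hβ : ∀ j, relColemanSeries (isUniformizer_unit_mul h2 u) E hq hE hσ₀ (β j) =
      PowerSeries.subst ((hom (isLTRing_LTCoeff (isUniformizer_unit_mul h2 u)) (isLTSeries_LTCoeff _) (isLTSeries_LTCoeff _)
          (LTCoeff.of (v.adicCompletion K) (a : 𝒪[v.adicCompletion K]))).map (algebraMap (LTCoeff (v.adicCompletion K)) (unitBall E)))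
        (PowerSeries.subst ((hom (isLTRing_LTCoeff (isUniformizer_unit_mul h2 u))
            (isLTSeries_map_LTCoeff_of_degree_one ((integerEquivAdicCompletionIntegers v).trans (padicIntEquivOfDegreeOne K 2 v he hf)) hq heπ hPlt)
            (isLTSeries_LTCoeff _) 1).map (algebraMap (LTCoeff (v.adicCompletion K)) (unitBall E))) (G j)))
    -- the `φ`-direction semiconjugation of the reading (`τ′ = σ_v|_R`) and the conjugate base point `(τ′x₀, τ′y₀) = ξ(Ω′)`
    (τ' : R →+* R) (hτ' : (frobUnitBall E σ₀ : unitBall E →+* unitBall E).comp ψ𝔓 = ψ𝔓.comp τ') (hWτ' : WR.map τ' = WR)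
    (hKτ' : ∀ j, τ' (Kc j) = Kc j) (eι' : J → ℂ → ℂ) (heT' : ∀ j, ∀ c ∈ (S j).erase 0, eι' j c ∈ (S j).erase 0)
    (hinj' : ∀ j, Set.InjOn (eι' j) ((S j).erase 0)) (hsurj' : ∀ j, Set.SurjOn (eι' j) ((S j).erase 0) ((S j).erase 0))
    (hxτ' : ∀ j, ∀ c ∈ (S j).erase 0, τ' (x j c) = x j (eι' j c))
    (Ω' : ℂ) (hΩ' : ∀ j, Ω' ∉ (L' j).lattice)
    (ha' : φC (τ' x₀) = ℘[L] Ω' - WC.b₂ / 12) (hb' : φC (τ' y₀) = (℘'[L] Ω' - WC.a₁ * (℘[L] Ω' - WC.b₂ / 12) - WC.a₃) / 2) :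
    ∀ (j : J) (k : ℕ),
      (ρ (PowerSeries.constantCoeff ((fun g : PowerSeries (unitBall E) =>
          (invDiff (isLTRing_LTCoeff (isUniformizer_unit_mul h2 u))
              (isLTSeries_LTCoeff ((u : 𝒪[v.adicCompletion K]) * ((2 : ℕ) : 𝒪[v.adicCompletion K])))).map
              (algebraMap (LTCoeff (v.adicCompletion K)) (unitBall E)) *
            PowerSeries.derivative (unitBall E) g)^[k] (relLogDerivSeries (isUniformizer_unit_mul h2 u) E hq hE hσ₀ (β j)))) =
        (φF ((a : 𝒪[v.adicCompletion K]) : v.adicCompletion K)) ^ (k + 1) *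
          ((ιp.symm (-12 * (((S j).card : ℂ) * L.eisensteinE (k + 1) Ω - (L' j).eisensteinE (k + 1) Ω)) : PadicAlgCl 2) : ℂ_[2])) ∧
      ρ ((frobUnitBall E σ₀ : unitBall E →+* unitBall E) (PowerSeries.constantCoeff ((fun g : PowerSeries (unitBall E) =>
          (invDiff (isLTRing_LTCoeff (isUniformizer_unit_mul h2 u))
              (isLTSeries_LTCoeff ((u : 𝒪[v.adicCompletion K]) * ((2 : ℕ) : 𝒪[v.adicCompletion K])))).map
              (algebraMap (LTCoeff (v.adicCompletion K)) (unitBall E)) *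
            PowerSeries.derivative (unitBall E) g)^[k] (relLogDerivSeries (isUniformizer_unit_mul h2 u) E hq hE hσ₀ (β j))))) =
        (φF ((a : 𝒪[v.adicCompletion K]) : v.adicCompletion K)) ^ (k + 1) *
          ((ιp.symm (-12 * (((S j).card : ℂ) * L.eisensteinE (k + 1) Ω' - (L' j).eisensteinE (k + 1) Ω')) : PadicAlgCl 2) : ℂ_[2]) := by
  intro j k
  refine ⟨?_, ?_⟩
  · have h := map_relCoatesWiles_eq_of_bridge_series K v he hf hq h2 u E hE hσ₀ (β j) k ρ φF hρ ιp V hP heπ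
      (isLTSeries_map_LTCoeff_of_degree_one ((integerEquivAdicCompletionIntegers v).trans (padicIntEquivOfDegreeOne K 2 v he hf))
        hq heπ hPlt) (LTCoeff.of (v.adicCompletion K) (a : 𝒪[v.adicCompletion K])) (G j) (hβ j) WR x₀ y₀ (x j) (uc j) (Kc j) φC WC L
      (hS j) hg₂ hg₃ (hΩ j) hV ha hb (hK j) (hx j) (hu j) ψ𝔓 (hG j) hQθ hW
    rwa [RingEquiv.symm_apply_apply] at h
  · obtain ⟨uc', huc', hGφ⟩ := iterate_map_thetaTExpansion_of_semiconj WR x₀ y₀ ψ𝔓 (frobUnitBall E σ₀ : unitBall E →+* unitBall E) τ'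
      ((S j).erase 0) (x j) (uc j) (Kc j) (eι' j) hτ' hWτ' (hKτ' j) (hu j) (heT' j) (hinj' j) (hsurj' j) (hxτ' j) 1
    simp only [Function.iterate_one] at huc' hGφ
    rw [← hG j] at hGφ
    have h := map_frob_relCoatesWiles_eq_of_bridge_series K v he hf hq h2 u E hE hσ₀ (β j) k ρ φF hρ ιp V hP heπ
      (isLTSeries_map_LTCoeff_of_degree_one ((integerEquivAdicCompletionIntegers v).trans (padicIntEquivOfDegreeOne K 2 v he hf))
        hq heπ hPlt) (LTCoeff.of (v.adicCompletion K) (a : 𝒪[v.adicCompletion K])) (G j) (hβ j) WR (τ' x₀) (τ' y₀) (x j) uc' (Kc j) φC WC L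
      (hS j) hg₂ hg₃ (hΩ' j) hV ha' hb' (hK j) (hx j) huc' ψ𝔓 hGφ hQθ hW
    rwa [RingEquiv.symm_apply_apply] at h

end Summit.BirchSwinnertonDyer.BirchSwinnertonDyer.Theorems.PrintCf2.KatzMeasureJZeroSeam

end
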